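import Literature.MathematicalPhysics.QuantumFieldTheory.BalabanImbrieJaffe1984to88.BIJ88Eq541Base0
import Literature.MathematicalPhysics.QuantumFieldTheory.BalabanImbrieJaffe1984to88.BIJ88Eq5514ZTorus
import Literature.MathematicalPhysics.QuantumFieldTheory.BalabanImbrieJaffe1984to88.BIJ88Eq534Locality

/-!
# `BalabanImbrieJaffe1984to88.BIJ88Eq5514Base0` — T. Bałaban, J. Imbrie, A. Jaffe, *Effective action and cluster properties of the abelian
Higgs model*, Commun. Math. Phys. **114** (1988) 257–315 [BalabanImbrieJaffe1988], Sect. 5.5–5.6 pp. 285–287: **(5.5.14)**, **(5.6.1)/(5.6.6)**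
and the `w₅` sentence AT THE TORUS MODEL OF RECORD (base level `0`), with the nonlocal identity (5.4.1) = (2.20) DISCHARGED (gen 7's
`BIJ88Eq541Base0.eq541_base0`, p08's (2.20) `BIJ88Eq220Torus`) and the (5.3.4) locality DISCHARGED (this gen's `BIJ88Eq534Locality`) — so that
the displays hold for the ACTUAL operators `Q^{s*}_k`, `T_k = 𝒟_k∂*Q^{e*}_k`, `H_k`, `C_k`, `Q^{e*}` and the ACTUAL exponent of (4.2), the
remaining hypotheses being range statements, (5.5.11), and the principal-branch smallness (kind «model instance»).

statement-level skeleton of published theorems with citation tags; proofs where landed; nothing here is a claim about the Yang–Mills mass gap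

PDF held: `paper:balaban1988-cmp114-bij-abelian-higgs-effective-action` (journal page = PDF page + 256); pp. 285–286 [PDF 29–30] rendered and
read as images this session (seat folder `renders/original-p029-x2.png`, `original-p030-x2.png`).

CITATION HEADER (lean-in-tree rule).  Part of the lit-balaban TYPED SKELETON (HOME `run/shared/lean/pub/lit-balaban/`), PHASE-2 proof
seat p31 gen 8 (unit `lit-balaban-p31-g8`; fourth file of the gen after `BIJ88Eq5514Torus` p299521, `BIJ88Eq534Locality` p299857,
`BIJ88Eq5514ZTorus` p299968; TAKING line HOME/STATUS.md 2026-08-21T19:12:37Z).  WHAT IS REPRODUCED: rows `C2.Eq5.5.13-5.5.14`, `C2.Eq5.6.1-5.6.2`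
(member (5.6.1)), `C2.Eq5.6.6-5.6.12` (member (5.6.6)) of `HOME/lit-balaban-r16/ROWS-C2-part2.md` (owner r16) at base `0`, exactly as gen 7's
`BIJ88Eq541Base0` did for (5.4.4)/(5.4.6)/(5.4.9)/(5.4.10).

THE PRINTED TEXT (verbatim, p. 285): *"In Λ₅^{(k)*} we apply (5.5.11) to obtain u′_k = (Q^{s*}_{k+1}v) exp ie_kη[H_{k,loc}A^{(k)} − L^{−2}𝒟^η_{k+1,loc}
∂*Q^{e*}_{k+1}f + w₁A′]. (5.5.14) The same formula holds in Λ̄₅^{(k)*} for the gauge field in the normalization factors, except that we have w₅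
instead of w₁."*; p. 287: *"ũ_{k+1}ũ = ũ_{k+1} exp ie_kη[θ_kH_{k,loc}A^{(k)} + w₁A′] = ũ_{k+1}e^{ie_kηÃ}. (5.6.6)"*.

WHAT IS DATA, and what is discharged.  CONCRETE (the model of record at base `0`: η-lattice = level `0`, unit lattice = level `0 + k`, blocks
= level `0 + k + 1`): `Q^{s*}_k = (torusBlockBondsIter P 0 k).Qsstar` (= p30's `QsstarIter`, gen 7's `Qsstar_base0`), `Q^{s*}_{k+1}v =
qsstarGIter (k+1) v`, `T_k = TkF`, `H_k = HkF`, `C_k = CkF` (gen 7: the operators of record `DkE`, `(curlOp)†`, `QesOp`, `HkE`, `CkE` on plain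
carriers; weight `w > 0`, `ηL^k = 1`), `Q^{e*} = qstarLin` ((2.22), p30), `L = P.L`, `∂ = curl 1`, `∂^η = grad η⁻¹`, `f(p′) =
(1/e_k)argB v(∂p′)`, the translated configuration `u = u′(Λ₁′*Q^{s*}v)`, `u′ = e^{ie_k(A^{(k)} − L^{−2}V)}` on `Λ₁^{(k)*}`.  DATA: the localized
operators `𝒟_{k,loc}`, `S = ∂*Q^{e*}_k` (as the factor of `T_loc = 𝒟_{k,loc}S`), `H_{k,loc}`, `C^{(k)}_{loc}`, `H*_{k,loc}`, `𝒟^η_{k+1,loc}` (linear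
maps; no torus construction of the LOCALIZED kernels exists in the tree), the translation vector `V`, `θ_k`, the cubes/regions.  DISCHARGED:
(5.4.1) (`eq541_base0`), the (5.3.4) locality for the ACTUAL exponent `g = T_loc f^{(k)}` (`locality534`, in `eq5514_base0_actual`).
HYPOTHESES LEFT: the range statements `hdepT` (`T_loc` at `b` sees only `Λ₁**`), `hdep` (only `□**`), `hΛ₄` (`Λ₄*` invisible to `H_{k,loc}` at
`b`), for `w₅` also `hfar3`/`hS3`; (5.5.11) `h5511` (= `BIJ88Eq5514ZTorus.h5511_of_sum212` for the (2.12) sums); the real field strength `hF`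
and the smallness `hsmall` (= `BIJ88Eq534Locality.small_of_bounds` from `|A′| ≦ cp(e_k)`, `|f| ≦ cp(e_k)`).

WHAT IS PROVED (theorems only; 0 `sorry`, standard axioms, no `def`, no `Prop`-valued fact introduced).
* **`eq5514_base0`** ((5.5.14) at base 0, (5.4.1) discharged), **`eq566_base0`** ((5.6.1)/(5.6.6) at base 0), **`eq5514Z_base0`** (the `w₅`
  sentence at base 0), **`eq5514_base0_actual`** ((5.5.14) at base 0 with BOTH (5.4.1) and the (5.3.4) locality discharged: the exponent of
  (4.2) is the actual `T_loc f^{(k)}`).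
Imports: gen 7's `BIJ88Eq541Base0` (p270397), this gen's `BIJ88Eq5514ZTorus` (p299968, → `BIJ88Eq5514Torus` p299521) and `BIJ88Eq534Locality`
(p299857).  Unit `lit-balaban-p31` (literature-prover-lit-balaban-p31-g8-0), 2026-08-21.
-/

namespace Literature.MathematicalPhysics.QuantumFieldTheory.BalabanImbrieJaffe1984to88.BIJ88Eq5514Base0

open Literature.MathematicalPhysics.QuantumFieldTheory.Balaban1983to89
open BIJ88Sect3Statements (U1 toC starB starP fieldStrength)
open BIJ88Sect4Statements (backgroundU bgGaugeU)
open BIJ88Sect5StatementsPart3 (bgExp uTilde561 uSmall566)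
open BIJ85Sect1Model (argB)
open BIJ85BlockAveragesTorus (expU1 surfMul)
open BIJ85Eq453GaugeField (qsstarGIter)
open BIJ85Eq224Proof (torusBlockBondsIter)
open BIJ85Eq611Torus (qstarLin)
open BIJ88Eq536Linearization (cutoff)
open BIJ88Eq533Torus (blockUnion)
open BIJ88Eq541Base0 (TkF HkF CkF eq541_base0)
open BIJ88Eq5514Torus (eq5514_torus eq566_torus)
open BIJ88Eq5514ZTorus (eq5514Z_torus)
open BIJ88Eq534Locality (locality534)
open GaugeField (plaqHol)
open LatticeFieldCalculus (grad curl)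
open scoped BigOperators Real
open Complex Finset

noncomputable section

variable {P : Params}

/-- **(5.5.14) AT THE TORUS MODEL OF RECORD, base 0, (5.4.1) discharged** (`BIJ88Eq5514Torus.eq5514_torus` with `h541 := eq541_base0`): for
the ACTUAL `Q^{s*}_k`, `T_k = 𝒟_k∂*Q^{e*}_k`, `H_k`, `C_k` (gen 7's `TkF`/`HkF`/`CkF`, weight `w > 0`, `ηL^k = 1`, `2 ≤ d`) and localized data
`𝒟_{k,loc}`, `S`, `H_{k,loc}`, `C^{(k)}_{loc}`, `H*_{k,loc}`, `𝒟^η_{k+1,loc}`, at a bond `b ∈ □₀ ∩ Λ̄₁^{(k)*} ∩ Λ̄₃^{(k)*}` under `hT` (the (5.3.4)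
locality), `hdep`, `hΛ₄`, `h5511`: the `bgGaugeU`-transformed translated background field at `b` is `(Q^{s*}_{k+1}v)(b) · exp ie_kη[H_{k,loc}A^{(k)}
− L^{−2}𝒟^η_{k+1,loc}X_f + w₁A′](b)`, `X_f = S(Q^{e*}f)`, `w₁A′ = (T_k − 𝒟_{k,loc}S)∂(□A′) + H_k(□A′) − H_{k,loc}A′`, `A′ = A^{(k)} − L^{−2}V` (η-lattice =
level `0`, unit lattice = level `0 + k`, blocks = level `0 + k + 1`). [cite: BalabanImbrieJaffe1988, (5.5.14) p.285] -/
theorem eq5514_base0 (hd : 2 ≤ P.d) {k : ℕ} (hk : k + 1 ≤ P.m + P.K) {ek η : ℝ} (hη : η * (P.L : ℝ) ^ k = 1) {w : ℝ} (hw : 0 < w)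
    (X : Finset (Balaban1983to89.Site P (0 + k + 1))) {u' : GaugeField P (0 + k) U1} (A V : PBond P (0 + k) → ℝ) (L : ℝ)
    (hu : ∀ c ∈ starB (blockUnion 1 X), u' c = expU1 (ek * (A - L⁻¹ ^ 2 • V) c)) (v : GaugeField P (0 + k + 1) U1) (g : PBond P 0 → ℝ)
    {Plc : Type*} (Dloc Dnext : (PBond P 0 → ℝ) →ₗ[ℝ] (PBond P 0 → ℝ)) (S : (Balaban1983to89.Plaq P (0 + k) → ℝ) →ₗ[ℝ] (PBond P 0 → ℝ))
    (Hloc : (PBond P (0 + k) → ℝ) →ₗ[ℝ] (PBond P 0 → ℝ))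
    (Cloc : (PBond P (0 + k) → ℝ) →ₗ[ℝ] (PBond P (0 + k) → ℝ)) (Hsloc : (PBond P 0 → ℝ) →ₗ[ℝ] (PBond P (0 + k) → ℝ))
    (h5511 : Dloc + Hloc ∘ₗ Cloc ∘ₗ Hsloc = Dnext)
    (Qes : (Plc → ℝ) →ₗ[ℝ] (Balaban1983to89.Plaq P (0 + k) → ℝ)) (f : Plc → ℝ)
    (Xb X₀ : Finset (Balaban1983to89.Site P (0 + k))) (hX₀ : X₀ ⊆ Xb) (S₃ : Finset (Balaban1983to89.Site P 0))
    {b : PBond P 0} (hb₁ : b ∈ starB (blockUnion (k + 1) X)) (hb₀ : b ∈ starB (blockUnion k X₀)) (hb₃ : b ∈ starB S₃)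
    (hT : g b = Dloc (S (curl 1 (A - L⁻¹ ^ 2 • V) + L⁻¹ ^ 2 • Qes f)) b)
    (hdep : ∀ F₁ F₂ : Balaban1983to89.Plaq P (0 + k) → ℝ, (∀ p ∈ starP Xb, F₁ p = F₂ p) → Dloc (S F₁) b = Dloc (S F₂) b)
    (hΛ₄ : Hloc V b = Hloc (Cloc (Hsloc (S (Qes f)))) b) :
    bgGaugeU ek η ((↑S₃ : Set (Balaban1983to89.Site P 0)).indicator
        (CkF P hd w η (0 + k) ((↑(starB Xb) : Set (PBond P (0 + k))).indicator (A - L⁻¹ ^ 2 • V))))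
        (backgroundU ek η (fun b => toC (qsstarGIter k (surfMul u' (cutoff (starB X) v)) b)) g) b =
      bgExp ek η (fun b => toC (qsstarGIter (k + 1) v b))
        (fun b => Hloc A b - L⁻¹ ^ 2 * Dnext (S (Qes f)) b +
          ((TkF P hd w η (0 + k) (curl 1 ((↑(starB Xb) : Set (PBond P (0 + k))).indicator (A - L⁻¹ ^ 2 • V))) b -
              Dloc (S (curl 1 ((↑(starB Xb) : Set (PBond P (0 + k))).indicator (A - L⁻¹ ^ 2 • V)))) b) +
            (HkF P w η (0 + k) ((↑(starB Xb) : Set (PBond P (0 + k))).indicator (A - L⁻¹ ^ 2 • V)) b - Hloc (A - L⁻¹ ^ 2 • V) b))) b :=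
  eq5514_torus (by omega) hη X A V L hu v g (TkF P hd w η (0 + k)) Dloc Dnext S (HkF P w η (0 + k)) Hloc (CkF P hd w η (0 + k)) Cloc Hsloc
    (eq541_base0 hd (by omega) hη hw) h5511 Qes f Xb X₀ hX₀ S₃ hb₁ hb₀ hb₃ hT hdep hΛ₄

/-- **(5.6.1)/(5.6.6) AT THE TORUS MODEL OF RECORD, base 0, (5.4.1) discharged** (`BIJ88Eq5514Torus.eq566_torus` with `h541 := eq541_base0`):
in the setting of `eq5514_base0`, for any `θ_k`, the field at `b` is `ũ_{k+1}(b)·ũ(b)` with r16's `uTilde561 e_k η L (Q^{s*}_{k+1}v) θ_k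
(H_{k,loc}A^{(k)}) (𝒟^η_{k+1,loc}X_f)` ((5.6.1)) and `uSmall566 e_k η θ_k (H_{k,loc}A^{(k)}) (w₁A′)` ((5.6.6)). [cite: BalabanImbrieJaffe1988, (5.6.6) p.287] -/
theorem eq566_base0 (hd : 2 ≤ P.d) {k : ℕ} (hk : k + 1 ≤ P.m + P.K) {ek η : ℝ} (hη : η * (P.L : ℝ) ^ k = 1) {w : ℝ} (hw : 0 < w)
    (X : Finset (Balaban1983to89.Site P (0 + k + 1))) {u' : GaugeField P (0 + k) U1} (A V : PBond P (0 + k) → ℝ) (L : ℝ)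
    (hu : ∀ c ∈ starB (blockUnion 1 X), u' c = expU1 (ek * (A - L⁻¹ ^ 2 • V) c)) (v : GaugeField P (0 + k + 1) U1) (g : PBond P 0 → ℝ)
    {Plc : Type*} (Dloc Dnext : (PBond P 0 → ℝ) →ₗ[ℝ] (PBond P 0 → ℝ)) (S : (Balaban1983to89.Plaq P (0 + k) → ℝ) →ₗ[ℝ] (PBond P 0 → ℝ))
    (Hloc : (PBond P (0 + k) → ℝ) →ₗ[ℝ] (PBond P 0 → ℝ))
    (Cloc : (PBond P (0 + k) → ℝ) →ₗ[ℝ] (PBond P (0 + k) → ℝ)) (Hsloc : (PBond P 0 → ℝ) →ₗ[ℝ] (PBond P (0 + k) → ℝ))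
    (h5511 : Dloc + Hloc ∘ₗ Cloc ∘ₗ Hsloc = Dnext)
    (Qes : (Plc → ℝ) →ₗ[ℝ] (Balaban1983to89.Plaq P (0 + k) → ℝ)) (f : Plc → ℝ)
    (Xb X₀ : Finset (Balaban1983to89.Site P (0 + k))) (hX₀ : X₀ ⊆ Xb) (S₃ : Finset (Balaban1983to89.Site P 0))
    {b : PBond P 0} (hb₁ : b ∈ starB (blockUnion (k + 1) X)) (hb₀ : b ∈ starB (blockUnion k X₀)) (hb₃ : b ∈ starB S₃)
    (hT : g b = Dloc (S (curl 1 (A - L⁻¹ ^ 2 • V) + L⁻¹ ^ 2 • Qes f)) b)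
    (hdep : ∀ F₁ F₂ : Balaban1983to89.Plaq P (0 + k) → ℝ, (∀ p ∈ starP Xb, F₁ p = F₂ p) → Dloc (S F₁) b = Dloc (S F₂) b)
    (hΛ₄ : Hloc V b = Hloc (Cloc (Hsloc (S (Qes f)))) b) (θ : PBond P 0 → ℝ) :
    bgGaugeU ek η ((↑S₃ : Set (Balaban1983to89.Site P 0)).indicator
        (CkF P hd w η (0 + k) ((↑(starB Xb) : Set (PBond P (0 + k))).indicator (A - L⁻¹ ^ 2 • V))))
        (backgroundU ek η (fun b => toC (qsstarGIter k (surfMul u' (cutoff (starB X) v)) b)) g) b =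
      uTilde561 ek η L (fun b => toC (qsstarGIter (k + 1) v b)) θ (Hloc A) (Dnext (S (Qes f))) b *
        uSmall566 ek η θ (Hloc A)
          (fun b => (TkF P hd w η (0 + k) (curl 1 ((↑(starB Xb) : Set (PBond P (0 + k))).indicator (A - L⁻¹ ^ 2 • V))) b -
              Dloc (S (curl 1 ((↑(starB Xb) : Set (PBond P (0 + k))).indicator (A - L⁻¹ ^ 2 • V)))) b) +
            (HkF P w η (0 + k) ((↑(starB Xb) : Set (PBond P (0 + k))).indicator (A - L⁻¹ ^ 2 • V)) b - Hloc (A - L⁻¹ ^ 2 • V) b)) b :=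
  eq566_torus (by omega) hη X A V L hu v g (TkF P hd w η (0 + k)) Dloc Dnext S (HkF P w η (0 + k)) Hloc (CkF P hd w η (0 + k)) Cloc Hsloc
    (eq541_base0 hd (by omega) hη hw) h5511 Qes f Xb X₀ hX₀ S₃ hb₁ hb₀ hb₃ hT hdep hΛ₄ θ

/-- **The `w₅` sentence AT THE TORUS MODEL OF RECORD, base 0, (5.4.1) discharged** (`BIJ88Eq5514ZTorus.eq5514Z_torus` with `h541 :=
eq541_base0`): the gauge field of the normalization factors — `bgGaugeU` with the NONLOCAL gauge function `C_k(Λ₃*A′)`, `C_k` the ACTUAL (2.22)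
operator — at a bond `b ∈ Λ̄₁^{(k)*}` under `hT`, `hfar3`, `hS3`, `hΛ₄`, `h5511` is `(Q^{s*}_{k+1}v)(b) · exp ie_kη[H_{k,loc}A^{(k)} − L^{−2}𝒟^η_{k+1,loc}
X_f + w₅A′](b)`, `w₅A′ = (T_k − 𝒟_{k,loc}S)∂(Λ₃*A′) + (H_k − H_{k,loc})(Λ₃*A′)`. [cite: BalabanImbrieJaffe1988, (5.5.14) p.285] -/
theorem eq5514Z_base0 (hd : 2 ≤ P.d) {k : ℕ} (hk : k + 1 ≤ P.m + P.K) {ek η : ℝ} (hη : η * (P.L : ℝ) ^ k = 1) {w : ℝ} (hw : 0 < w)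
    (X : Finset (Balaban1983to89.Site P (0 + k + 1))) {u' : GaugeField P (0 + k) U1} (A V : PBond P (0 + k) → ℝ) (L : ℝ)
    (hu : ∀ c ∈ starB (blockUnion 1 X), u' c = expU1 (ek * (A - L⁻¹ ^ 2 • V) c)) (v : GaugeField P (0 + k + 1) U1) (g : PBond P 0 → ℝ)
    {Plc : Type*} (Dloc Dnext : (PBond P 0 → ℝ) →ₗ[ℝ] (PBond P 0 → ℝ)) (Sop : (Balaban1983to89.Plaq P (0 + k) → ℝ) →ₗ[ℝ] (PBond P 0 → ℝ))
    (Hloc : (PBond P (0 + k) → ℝ) →ₗ[ℝ] (PBond P 0 → ℝ))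
    (Cloc : (PBond P (0 + k) → ℝ) →ₗ[ℝ] (PBond P (0 + k) → ℝ)) (Hsloc : (PBond P 0 → ℝ) →ₗ[ℝ] (PBond P (0 + k) → ℝ))
    (h5511 : Dloc + Hloc ∘ₗ Cloc ∘ₗ Hsloc = Dnext)
    (Qes : (Plc → ℝ) →ₗ[ℝ] (Balaban1983to89.Plaq P (0 + k) → ℝ)) (f : Plc → ℝ) (S₃ : Finset (PBond P (0 + k)))
    {b : PBond P 0} (hb₁ : b ∈ starB (blockUnion (k + 1) X))
    (hT : g b = Dloc (Sop (curl 1 (A - L⁻¹ ^ 2 • V) + L⁻¹ ^ 2 • Qes f)) b)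
    (hfar3 : (torusBlockBondsIter P 0 k).Qsstar ((↑S₃ᶜ : Set (PBond P (0 + k))).indicator (A - L⁻¹ ^ 2 • V)) b -
      Dloc (Sop (curl 1 ((↑S₃ᶜ : Set (PBond P (0 + k))).indicator (A - L⁻¹ ^ 2 • V)))) b = 0)
    (hS3 : Hloc ((↑S₃ : Set (PBond P (0 + k))).indicator (A - L⁻¹ ^ 2 • V)) b = Hloc (A - L⁻¹ ^ 2 • V) b)
    (hΛ₄ : Hloc V b = Hloc (Cloc (Hsloc (Sop (Qes f)))) b) :
    bgGaugeU ek η (CkF P hd w η (0 + k) ((↑S₃ : Set (PBond P (0 + k))).indicator (A - L⁻¹ ^ 2 • V)))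
        (backgroundU ek η (fun b => toC (qsstarGIter k (surfMul u' (cutoff (starB X) v)) b)) g) b =
      bgExp ek η (fun b => toC (qsstarGIter (k + 1) v b))
        (fun b => Hloc A b - L⁻¹ ^ 2 * Dnext (Sop (Qes f)) b +
          ((TkF P hd w η (0 + k) (curl 1 ((↑S₃ : Set (PBond P (0 + k))).indicator (A - L⁻¹ ^ 2 • V))) b -
              Dloc (Sop (curl 1 ((↑S₃ : Set (PBond P (0 + k))).indicator (A - L⁻¹ ^ 2 • V)))) b) +
            (HkF P w η (0 + k) ((↑S₃ : Set (PBond P (0 + k))).indicator (A - L⁻¹ ^ 2 • V)) b -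
              Hloc ((↑S₃ : Set (PBond P (0 + k))).indicator (A - L⁻¹ ^ 2 • V)) b))) b :=
  eq5514Z_torus (by omega) hη X A V L hu v g (TkF P hd w η (0 + k)) Dloc Dnext Sop (HkF P w η (0 + k)) Hloc (CkF P hd w η (0 + k)) Cloc
    Hsloc (eq541_base0 hd (by omega) hη hw) h5511 Qes f S₃ hb₁ hT hfar3 hS3 hΛ₄

/-- **(5.5.14) AT THE TORUS MODEL OF RECORD, base 0, with (5.4.1) AND the (5.3.4) locality discharged.**  For the ACTUAL exponent of (4.2),
`g = T_loc f^{(k)}` with `T_loc = 𝒟_{k,loc} ∘ S` (`S = ∂*Q^{e*}_k`; both data, entering only through the range of `T_loc` at `b` inside `Λ₁^{(k)**}`,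
`hdepT`, and inside `□**`, `hdep`) and `f^{(k)}` the real plaquette field of the translated configuration (`hF`), the CONCRETE `Q^{e*} =
qstarLin` ((2.22)), `L = P.L`, `f(p′) = (1/e_k)argB v(∂p′)`, under the principal-branch smallness `hsmall`, at `b ∈ □₀ ∩ Λ̄₁^{(k)*} ∩ Λ̄₃^{(k)*}`
with `hΛ₄`, `h5511`: the `bgGaugeU`-transformed background field (4.2) `backgroundU e_k η (Q^{s*}_ku) (T_loc f^{(k)})` at `b` is
`(Q^{s*}_{k+1}v)(b) · exp ie_kη[H_{k,loc}A^{(k)} − L^{−2}𝒟^η_{k+1,loc}X_f + w₁A′](b)` (`w > 0`, `ηL^k = 1`, `2 ≤ d`, `e_k ≠ 0`).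
[cite: BalabanImbrieJaffe1988, (5.5.14) p.285] -/
theorem eq5514_base0_actual (hd : 2 ≤ P.d) {k : ℕ} (hk : k + 1 ≤ P.m + P.K) {ek η : ℝ} (hek : ek ≠ 0) (hη : η * (P.L : ℝ) ^ k = 1)
    {w : ℝ} (hw : 0 < w)
    (X : Finset (Balaban1983to89.Site P (0 + k + 1))) {u' : GaugeField P (0 + k) U1} (A V : PBond P (0 + k) → ℝ)
    (hu : ∀ c ∈ starB (blockUnion 1 X), u' c = expU1 (ek * (A - (P.L : ℝ)⁻¹ ^ 2 • V) c)) (v : GaugeField P (0 + k + 1) U1)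
    (Dloc Dnext : (PBond P 0 → ℝ) →ₗ[ℝ] (PBond P 0 → ℝ)) (S : (Balaban1983to89.Plaq P (0 + k) → ℝ) →ₗ[ℝ] (PBond P 0 → ℝ))
    (Hloc : (PBond P (0 + k) → ℝ) →ₗ[ℝ] (PBond P 0 → ℝ))
    (Cloc : (PBond P (0 + k) → ℝ) →ₗ[ℝ] (PBond P (0 + k) → ℝ)) (Hsloc : (PBond P 0 → ℝ) →ₗ[ℝ] (PBond P (0 + k) → ℝ))
    (h5511 : Dloc + Hloc ∘ₗ Cloc ∘ₗ Hsloc = Dnext)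
    (Xb X₀ : Finset (Balaban1983to89.Site P (0 + k))) (hX₀ : X₀ ⊆ Xb) (S₃ : Finset (Balaban1983to89.Site P 0))
    {b : PBond P 0} (hb₁ : b ∈ starB (blockUnion (k + 1) X)) (hb₀ : b ∈ starB (blockUnion k X₀)) (hb₃ : b ∈ starB S₃)
    (hdepT : ∀ F₁ F₂ : Balaban1983to89.Plaq P (0 + k) → ℝ, (∀ p ∈ starP (blockUnion 1 X), F₁ p = F₂ p) →
      Dloc (S F₁) b = Dloc (S F₂) b)
    (hdep : ∀ F₁ F₂ : Balaban1983to89.Plaq P (0 + k) → ℝ, (∀ p ∈ starP Xb, F₁ p = F₂ p) → Dloc (S F₁) b = Dloc (S F₂) b)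
    (F : Balaban1983to89.Plaq P (0 + k) → ℝ)
    (hF : ∀ p ∈ starP (blockUnion 1 X), (F p : ℂ) = fieldStrength ek (toC (plaqHol (surfMul u' (cutoff (starB X) v)) p)))
    (hsmall : ∀ p ∈ starP (blockUnion 1 X),
      |ek * (curl 1 (A - (P.L : ℝ)⁻¹ ^ 2 • V) p +
        (P.L : ℝ)⁻¹ ^ 2 * qstarLin P hd (0 + k) (fun q => argB (toC (plaqHol v q)) / ek) p)| < π)
    (hΛ₄ : Hloc V b = Hloc (Cloc (Hsloc (S (qstarLin P hd (0 + k) (fun q => argB (toC (plaqHol v q)) / ek))))) b) :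
    bgGaugeU ek η ((↑S₃ : Set (Balaban1983to89.Site P 0)).indicator
        (CkF P hd w η (0 + k) ((↑(starB Xb) : Set (PBond P (0 + k))).indicator (A - (P.L : ℝ)⁻¹ ^ 2 • V))))
        (backgroundU ek η (fun b => toC (qsstarGIter k (surfMul u' (cutoff (starB X) v)) b)) (Dloc (S F))) b =
      bgExp ek η (fun b => toC (qsstarGIter (k + 1) v b))
        (fun b => Hloc A b - (P.L : ℝ)⁻¹ ^ 2 * Dnext (S (qstarLin P hd (0 + k) (fun q => argB (toC (plaqHol v q)) / ek))) b +
          ((TkF P hd w η (0 + k) (curl 1 ((↑(starB Xb) : Set (PBond P (0 + k))).indicator (A - (P.L : ℝ)⁻¹ ^ 2 • V))) b -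
              Dloc (S (curl 1 ((↑(starB Xb) : Set (PBond P (0 + k))).indicator (A - (P.L : ℝ)⁻¹ ^ 2 • V)))) b) +
            (HkF P w η (0 + k) ((↑(starB Xb) : Set (PBond P (0 + k))).indicator (A - (P.L : ℝ)⁻¹ ^ 2 • V)) b -
              Hloc (A - (P.L : ℝ)⁻¹ ^ 2 • V) b))) b :=
  eq5514_base0 hd hk hη hw X A V (P.L : ℝ) hu v (Dloc (S F)) Dloc Dnext S Hloc Cloc Hsloc h5511
    (qstarLin P hd (0 + k)) (fun q => argB (toC (plaqHol v q)) / ek) Xb X₀ hX₀ S₃ hb₁ hb₀ hb₃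
    (by
      have h := locality534 (by omega) hd hek X hu v (fun G b => Dloc (S G) b) hdepT F hF hsmall
      simpa only using h)
    hdep hΛ₄

end

end Literature.MathematicalPhysics.QuantumFieldTheory.BalabanImbrieJaffe1984to88.BIJ88Eq5514Base0
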